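import Summits.NavierStokesRegularity.NavierStokesRegularity.Theses.AxisymmetricExtremality
import Summits.NavierStokesRegularity.NavierStokesRegularity.Theorems.AxisymmetricExtremalityAxisymmetricKatoGlobalStubSereginLogSwirlOriginCutoffDivCurl
import Literature.Analysis.FluidPDE.VectorCalculusProofs
import HarnessLib

/-!
# Seregin 2022, §2 Step 4: the second cut-off `div`–`curl` (elliptic) bound
# `‖∇²(ζv̄)‖₂ ≤ c‖|∇ζ||∇v̄|‖₂ + c‖|∇²ζ||v̄|‖₂ + c‖curl (ζω_θe_θ)‖₂` — crux stmt-NavierStokesRegularity-15453 (`AxisymmetricExtremality.AxisymmetricKatoGlobal`), line registered, support for stub `stub_sereginLogSwirlOrigin`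

Support file (`--supports stmt-NavierStokesRegularity-15453`; theorems only, everything proved)
toward the registered stub `stub_sereginLogSwirlOrigin` = the named fact
`Literature.Analysis.FluidPDE.seregin2022_logSwirl_regularAtOrigin` (G. Seregin, J. Math. Fluid
Mech. 24 (2022), Paper 27 = arXiv:2201.00153, §2), sibling of `…CutoffDivCurl.lean` (the first
bound). Step 4 (arXiv p. 7) states, for the poloidal part `v̄` (`div v̄ = 0`, `curl v̄ = ω_θe_θ`)
and the cut-off `η`,

> `‖∇²(η³v̄)‖_{2,𝒞} ≤ c‖|∇η³||∇v̄|‖_{2,𝒞} + c‖|∇²η³||v̄|‖_{2,𝒞} + c‖curl (ω_θη³e_θ)‖_{2,𝒞}`,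

which rests on `-Δ(ζv̄) = curl (ζω_θe_θ) − ∇(v̄·∇ζ) + curl (∇ζ × v̄)` (`ζ = η³`, Lemma 2.1,
display (equforvbar), arXiv p. 5) and `‖∇²W‖₂ = ‖ΔW‖₂` for compactly supported `W`. Here, for a
general cut-off `ζ ∈ C³_c(ℝ³)` and a general field `w` of class `C³` and divergence free on an
open `U ⊇ tsupport ζ` (`W = ζw`, `|·|_F` the Frobenius norm, `∂ₖ = D(·)[e_k]`):

* `sum_integral_frobeniusNormSq_fderiv_fderiv_eq` — the **second-order `div`–`curl` identity**
  `∑ₖ ∫ |D∂ₖW|²_F = ∫ ‖curl curl W‖² + ∫ ∑ₖ (∂ₖ div W)²` for every `W ∈ C³_c(ℝ³; ℝ³)` (the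
  first-order identity, accepted `integral_frobeniusNormSq_fderiv_eq_of_hasCompactSupport`, for
  the fields `∂ₖW` — `curl ∂ₖW = ∂ₖ curl W`, `div ∂ₖW = ∂ₖ div W` — and for the divergence-free
  field `curl W`);
* `norm_curl_curl_smul_le`, `sum_sq_fderiv_divergence_smul_le` — pointwise
  `‖curl curl (ζw)‖ ≤ ‖curl (ζ curl w)‖ + ‖curlCLM‖²(‖Dζ‖‖Dw‖ + ‖D²ζ‖‖w‖)` and
  `∑ₖ (∂ₖ div (ζw))² ≤ 3(‖Dζ‖‖Dw‖ + ‖D²ζ‖‖w‖)²` (near the support `curl (ζw) = ζ curl w + curlCLM (Dζ ⊗ w)`,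
  `div (ζw) = Dζ·w`; the rank-one field `S = Dζ ⊗ w` has `‖DS‖ ≤ ‖Dζ‖‖Dw‖ + ‖D²ζ‖‖w‖`,
  `norm_fderiv_fderiv_smulRight_le`);
* `lintegral_sum_frobeniusNormSq_fderiv_fderiv_smul_le` (registered sub-goal; hypothesis form
  `…_le'`) — **`∫ ∑ₖ |D∂ₖ(ζw)|²_F ≤ 2∫ ‖curl (ζ curl w)‖² + (2‖curlCLM‖⁴ + 3) ∫ (‖Dζ‖‖Dw‖ + ‖D²ζ‖‖w‖)²`**
  in `[0, ∞]`. The axisymmetric specialisation (`w = v̄`, `curl v̄ = ΓJ = ω_θe_θ`) is the sibling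
  `…CutoffDivCurlPoloidal.lean`.

## Mathlib / tree search

Tree: `curl_fderiv_apply`, `divergence_fderiv_apply`, `frobeniusNormSq_eq_sum`
(`TaoEnstrophyLocalisationProofs`; its `lintegral_sum_frobeniusNormSq_fderiv_fderiv_le` is the
div-free whole-space `L²` version `∫ ∑ₖ|D∂ₖv|² ≤ 3∫‖D curl v‖²`), `divergence_curl_eq_zero_holds`
(`VectorCalculusProofs`), the sibling's `contDiff_cutoff_smul`, `fderiv_eq_zero_of_forall_notMem`,
`integrable_of_continuous_of_forall_notMem`. Mathlib:
`isBoundedBilinearMap_smulRight`, `IsBoundedBilinearMap.hasFDerivAt/deriv_apply`,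
`fderiv_clm_apply`, `ContinuousLinearMap.norm_smulRight_apply`.
`lean search 'frobeniusNormSq_fderiv_fderiv_eq|norm_curl_curl|fderiv_fderiv_smul_le'`: no matches
(2026-08-17).

## References

* G. Seregin, J. Math. Fluid Mech. 24 (2022), Paper No. 27 = arXiv:2201.00153, §2 Step 4 (arXiv
  p. 7, second "classical bound") and Lemma 2.1 (arXiv p. 5, (equforvbar)). [`Seregin2022LocalAxisym`]
-/

noncomputable section

open Set MeasureTheory Filter Topology Function
open scoped ENNReal RealInnerProductSpace
open Literature.Analysis.FluidPDE

-- `<Problem> = <Summit>` duplicates a namespace component by design (lakefile sets the same option).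
set_option linter.dupNamespace false

namespace Summit.NavierStokesRegularity.NavierStokesRegularity.Theorems.AxisymmetricKatoGlobal.EulerScaling

section Cutoff

variable {ζ : EuclideanSpace ℝ (Fin 3) → ℝ}
  {w : EuclideanSpace ℝ (Fin 3) → EuclideanSpace ℝ (Fin 3)} {U : Set (EuclideanSpace ℝ (Fin 3))}

/-! ### The identity `∑ₖ ∫ |D∂ₖW|² = ∫ ‖curl curl W‖² + ∫ |∇ div W|²` and the cut-off bound -/

/-- **Second-order `div`–`curl` identity for compactly supported fields.** For
`W ∈ C³_c(ℝ³; ℝ³)`, `∑ₖ ∫ |D(∂ₖW)|²_F = ∫ ‖curl curl W‖² + ∫ ∑ₖ (∂ₖ div W)²`: the first-order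
identity (accepted `integral_frobeniusNormSq_fderiv_eq_of_hasCompactSupport`) for the `C²_c`
fields `∂ₖW` (`curl ∂ₖW = ∂ₖ curl W`, `div ∂ₖW = ∂ₖ div W`) and for the divergence-free `C²_c` field
`curl W` (`∫ |D curl W|²_F = ∫ ‖curl curl W‖²`). [folklore] -/
theorem sum_integral_frobeniusNormSq_fderiv_fderiv_eq
    {W : EuclideanSpace ℝ (Fin 3) → EuclideanSpace ℝ (Fin 3)} (hW : ContDiff ℝ 3 W)
    (hWc : HasCompactSupport W) :
    ∑ k, ∫ x, frobeniusNormSq (fderiv ℝ (fun y => fderiv ℝ W y (EuclideanSpace.single k 1)) x) =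
      (∫ x, ‖curl (curl W) x‖ ^ 2) +
        ∫ x, ∑ k, fderiv ℝ (VectorCalculus.divergence W) x (EuclideanSpace.single k 1) ^ 2 := by
  have hW2 : ContDiff ℝ 2 W := hW.of_le (by norm_num)
  have hk2 : ∀ k : Fin 3, ContDiff ℝ 2 fun y => fderiv ℝ W y (EuclideanSpace.single k 1) :=
    fun k => (hW.fderiv_right (m := 2) (by norm_num)).clm_apply contDiff_const
  have hkc : ∀ k : Fin 3, HasCompactSupport fun y => fderiv ℝ W y (EuclideanSpace.single k 1) :=
    fun k => hWc.fderiv_apply (𝕜 := ℝ) _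
  have hc2 : ContDiff ℝ 2 (curl W) := contDiff_curl (n := 2) (by exact_mod_cast hW)
  have hcc : HasCompactSupport (curl W) := hasCompactSupport_curl hWc
  have hd2 : ContDiff ℝ 2 (VectorCalculus.divergence W) :=
    contDiff_divergence (n := 2) (by exact_mod_cast hW)
  have hc0 : ∀ y ∉ tsupport W, curl W y = 0 := fun y hy => curl_eq_zero_of_notMem_tsupport hy
  have hd0 : ∀ y ∉ tsupport W, VectorCalculus.divergence W y = 0 := fun y hy =>
    divergence_eq_zero_of_notMem_tsupport hy
  have e1 : ∀ k : Fin 3,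
      ∫ x, frobeniusNormSq (fderiv ℝ (fun y => fderiv ℝ W y (EuclideanSpace.single k 1)) x) =
        (∫ x, ‖fderiv ℝ (curl W) x (EuclideanSpace.single k 1)‖ ^ 2) +
          ∫ x, fderiv ℝ (VectorCalculus.divergence W) x (EuclideanSpace.single k 1) ^ 2 := by
    intro k
    rw [integral_frobeniusNormSq_fderiv_eq_of_hasCompactSupport (hk2 k) (hkc k)]
    simp_rw [curl_fderiv_apply hW2, divergence_fderiv_apply hW2]
  have e2 : ∫ x, ‖curl (curl W) x‖ ^ 2 = ∫ x, frobeniusNormSq (fderiv ℝ (curl W) x) := by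
    rw [integral_frobeniusNormSq_fderiv_eq_of_hasCompactSupport hc2 hcc]
    simp_rw [divergence_curl_eq_zero_holds W hW2]
    simp
  have hi1 : ∀ k : Fin 3,
      Integrable fun x => ‖fderiv ℝ (curl W) x (EuclideanSpace.single k 1)‖ ^ 2 := fun k =>
    integrable_of_continuous_of_forall_notMem hWc.isCompact
      (((hc2.continuous_fderiv two_ne_zero).clm_apply continuous_const).norm.pow 2) fun x hx => by
        rw [fderiv_eq_zero_of_forall_notMem (isClosed_tsupport W) hc0 hx]; simp
  have hi2 : ∀ k : Fin 3, Integrable fun x =>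
      fderiv ℝ (VectorCalculus.divergence W) x (EuclideanSpace.single k 1) ^ 2 := fun k =>
    integrable_of_continuous_of_forall_notMem hWc.isCompact
      (((hd2.continuous_fderiv two_ne_zero).clm_apply continuous_const).pow 2) fun x hx => by
        rw [fderiv_eq_zero_of_forall_notMem (isClosed_tsupport W) hd0 hx]; simp
  calc ∑ k, ∫ x, frobeniusNormSq (fderiv ℝ (fun y => fderiv ℝ W y (EuclideanSpace.single k 1)) x)
      = ∑ k : Fin 3, ((∫ x, ‖fderiv ℝ (curl W) x (EuclideanSpace.single k 1)‖ ^ 2) +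
          ∫ x, fderiv ℝ (VectorCalculus.divergence W) x (EuclideanSpace.single k 1) ^ 2) :=
        Finset.sum_congr rfl fun k _ => e1 k
    _ = (∫ x, ∑ k, ‖fderiv ℝ (curl W) x (EuclideanSpace.single k 1)‖ ^ 2) +
          ∫ x, ∑ k, fderiv ℝ (VectorCalculus.divergence W) x (EuclideanSpace.single k 1) ^ 2 := by
        rw [Finset.sum_add_distrib, integral_finsetSum _ fun k _ => hi1 k,
          integral_finsetSum _ fun k _ => hi2 k]
    _ = _ := by
        rw [e2]
        congr 1
        refine integral_congr_ae (ae_of_all _ fun x => ?_)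
        dsimp only
        rw [frobeniusNormSq_eq_sum (EuclideanSpace.basisFun (Fin 3) ℝ)]
        simp only [EuclideanSpace.basisFun_apply]

/-- Near a point of `U`, `div (ζw) = Dζ·w` (Leibniz rule and `div w = 0` on `U`). [folklore] -/
theorem divergence_smul_eventuallyEq (hζ : ContDiff ℝ 1 ζ) (hU : IsOpen U)
    (hw : ∀ y ∈ U, DifferentiableAt ℝ w y) (hdiv : ∀ y ∈ U, VectorCalculus.divergence w y = 0)
    {x : EuclideanSpace ℝ (Fin 3)} (hx : x ∈ U) :
    VectorCalculus.divergence (fun y => ζ y • w y) =ᶠ[𝓝 x] fun y => fderiv ℝ ζ y (w y) := by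
  filter_upwards [hU.mem_nhds hx] with y hy
  rw [divergence_smul_apply ((hζ.differentiable one_ne_zero) y) (hw y hy), hdiv y hy, mul_zero,
    zero_add, real_inner_comm, gradient, InnerProductSpace.toDual_symm_apply]

/-- Near a point of `U`, `curl (ζw) = ζ curl w + curlCLM (Dζ ⊗ w)` (Leibniz rule). [folklore] -/
theorem curl_smul_eventuallyEq (hζ : ContDiff ℝ 1 ζ) (hU : IsOpen U)
    (hw : ∀ y ∈ U, DifferentiableAt ℝ w y) {x : EuclideanSpace ℝ (Fin 3)} (hx : x ∈ U) :
    curl (fun y => ζ y • w y) =ᶠ[𝓝 x]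
      fun y => ζ y • curl w y + curlCLM ((fderiv ℝ ζ y).smulRight (w y)) := by
  filter_upwards [hU.mem_nhds hx] with y hy
  exact curl_smul ((hζ.differentiable one_ne_zero) y) (hw y hy)

/-- The derivative of the rank-one Jacobian field `S(y) = Dζ(y) ⊗ w(y)` (a bounded bilinear
function of `(Dζ, w)`). [folklore] -/
theorem hasFDerivAt_fderiv_smulRight (hζ : ContDiff ℝ 2 ζ) {x : EuclideanSpace ℝ (Fin 3)}
    (hwx : DifferentiableAt ℝ w x) :
    HasFDerivAt (fun y => (fderiv ℝ ζ y).smulRight (w y))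
      ((isBoundedBilinearMap_smulRight (𝕜 := ℝ) (E := EuclideanSpace ℝ (Fin 3))
          (F := EuclideanSpace ℝ (Fin 3))).deriv (fderiv ℝ ζ x, w x) ∘L
        ((fderiv ℝ (fderiv ℝ ζ) x).prod (fderiv ℝ w x))) x := by
  have hDζ : DifferentiableAt ℝ (fderiv ℝ ζ) x :=
    ((hζ.fderiv_right (m := 1) (by norm_num)).differentiable one_ne_zero) x
  exact (isBoundedBilinearMap_smulRight.hasFDerivAt (fderiv ℝ ζ x, w x)).comp x
    (hDζ.hasFDerivAt.prodMk hwx.hasFDerivAt)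

/-- `‖DS(x)‖ ≤ ‖Dζ‖ ‖Dw‖ + ‖D²ζ‖ ‖w‖` for `S = Dζ ⊗ w` (`‖ℓ ⊗ a‖ = ‖ℓ‖ ‖a‖`). [folklore] -/
theorem norm_fderiv_fderiv_smulRight_le (hζ : ContDiff ℝ 2 ζ) {x : EuclideanSpace ℝ (Fin 3)}
    (hwx : DifferentiableAt ℝ w x) :
    ‖fderiv ℝ (fun y => (fderiv ℝ ζ y).smulRight (w y)) x‖ ≤
      ‖fderiv ℝ ζ x‖ * ‖fderiv ℝ w x‖ + ‖fderiv ℝ (fderiv ℝ ζ) x‖ * ‖w x‖ := by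
  rw [(hasFDerivAt_fderiv_smulRight hζ hwx).fderiv]
  refine ContinuousLinearMap.opNorm_le_bound _ (by positivity) fun h => ?_
  rw [ContinuousLinearMap.comp_apply, ContinuousLinearMap.prod_apply,
    IsBoundedBilinearMap.deriv_apply]
  calc ‖(fderiv ℝ ζ x).smulRight (fderiv ℝ w x h) +
        (fderiv ℝ (fderiv ℝ ζ) x h).smulRight (w x)‖
      ≤ ‖(fderiv ℝ ζ x).smulRight (fderiv ℝ w x h)‖ +
          ‖(fderiv ℝ (fderiv ℝ ζ) x h).smulRight (w x)‖ := norm_add_le _ _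
    _ = ‖fderiv ℝ ζ x‖ * ‖fderiv ℝ w x h‖ + ‖fderiv ℝ (fderiv ℝ ζ) x h‖ * ‖w x‖ := by
        rw [ContinuousLinearMap.norm_smulRight_apply, ContinuousLinearMap.norm_smulRight_apply]
    _ ≤ ‖fderiv ℝ ζ x‖ * (‖fderiv ℝ w x‖ * ‖h‖) + ‖fderiv ℝ (fderiv ℝ ζ) x‖ * ‖h‖ * ‖w x‖ := by
        gcongr
        · exact (fderiv ℝ w x).le_opNorm h
        · exact (fderiv ℝ (fderiv ℝ ζ) x).le_opNorm h
    _ = (‖fderiv ℝ ζ x‖ * ‖fderiv ℝ w x‖ + ‖fderiv ℝ (fderiv ℝ ζ) x‖ * ‖w x‖) * ‖h‖ := by ring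

/-- **Pointwise second-order bound for the curl**: everywhere on `ℝ³`,
`‖curl curl (ζw)‖ ≤ ‖curl (ζ curl w)‖ + ‖curlCLM‖² (‖Dζ‖ ‖Dw‖ + ‖D²ζ‖ ‖w‖)`, for `ζ ∈ C²` and `w`
of class `C²` on an open `U ⊇ tsupport ζ` (`curl (ζw) = ζ curl w + curlCLM (Dζ ⊗ w)` near the
support; off it everything vanishes). Seregin: "`-Δ(ζv̄) = curl (ζω_θe_θ) − ∇(v̄·∇ζ) + curl (∇ζ × v̄)`".
[cite: Seregin2022LocalAxisym, §2 Lemma 2.1 proof, display (equforvbar) (arXiv:2201.00153 p. 5)] -/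
theorem norm_curl_curl_smul_le (hζ : ContDiff ℝ 2 ζ) (hU : IsOpen U) (hζU : tsupport ζ ⊆ U)
    (hw : ContDiffOn ℝ 2 w U) (x : EuclideanSpace ℝ (Fin 3)) :
    ‖curl (curl fun y => ζ y • w y) x‖ ≤ ‖curl (fun y => ζ y • curl w y) x‖ +
      ‖curlCLM‖ ^ 2 * (‖fderiv ℝ ζ x‖ * ‖fderiv ℝ w x‖ + ‖fderiv ℝ (fderiv ℝ ζ) x‖ * ‖w x‖) := by
  by_cases hx : x ∈ tsupport ζ
  · have hxU : x ∈ U := hζU hx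
    have hwx : ContDiffAt ℝ 2 w x := hw.contDiffAt (hU.mem_nhds hxU)
    have hwd : ∀ y ∈ U, DifferentiableAt ℝ w y := fun y hy =>
      (hw.contDiffAt (hU.mem_nhds hy)).differentiableAt two_ne_zero
    have hω : DifferentiableAt ℝ (curl w) x := by
      rw [curl_eq_curlCLM_comp]
      exact curlCLM.differentiableAt.comp x
        ((hwx.fderiv_right (m := 1) (by norm_num)).differentiableAt one_ne_zero)
    have hζd : DifferentiableAt ℝ ζ x := (hζ.differentiable two_ne_zero) x
    have hS := hasFDerivAt_fderiv_smulRight hζ (hwx.differentiableAt two_ne_zero)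
    have hG : HasFDerivAt (fun y => curlCLM ((fderiv ℝ ζ y).smulRight (w y)))
        (curlCLM ∘L fderiv ℝ (fun y => (fderiv ℝ ζ y).smulRight (w y)) x) x :=
      curlCLM.hasFDerivAt.comp x hS.differentiableAt.hasFDerivAt
    have hev := curl_smul_eventuallyEq (hζ.of_le (by norm_num)) hU hwd hxU
    rw [curl_eq_curlCLM (curl fun y => ζ y • w y), hev.fderiv_eq,
      fderiv_fun_add (hζd.fun_smul hω) hG.differentiableAt, hG.fderiv, map_add, ← curl_eq_curlCLM]
    refine (norm_add_le _ _).trans (add_le_add le_rfl ?_)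
    calc ‖curlCLM (curlCLM ∘L fderiv ℝ (fun y => (fderiv ℝ ζ y).smulRight (w y)) x)‖
        ≤ ‖curlCLM‖ * ‖curlCLM ∘L fderiv ℝ (fun y => (fderiv ℝ ζ y).smulRight (w y)) x‖ :=
          curlCLM.le_opNorm _
      _ ≤ ‖curlCLM‖ * (‖curlCLM‖ * ‖fderiv ℝ (fun y => (fderiv ℝ ζ y).smulRight (w y)) x‖) := by
          gcongr; exact ContinuousLinearMap.opNorm_comp_le _ _
      _ ≤ ‖curlCLM‖ * (‖curlCLM‖ *
            (‖fderiv ℝ ζ x‖ * ‖fderiv ℝ w x‖ + ‖fderiv ℝ (fderiv ℝ ζ) x‖ * ‖w x‖)) := by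
          gcongr; exact norm_fderiv_fderiv_smulRight_le hζ (hwx.differentiableAt two_ne_zero)
      _ = _ := by ring
  · have h0 : ∀ y ∉ tsupport ζ, curl (fun z => ζ z • w z) y = 0 := fun y hy =>
      curl_eq_zero_of_notMem_tsupport (notMem_tsupport_smul hy)
    rw [curl_eq_curlCLM (curl _), fderiv_eq_zero_of_forall_notMem (isClosed_tsupport ζ) h0 hx,
      map_zero, norm_zero]
    positivity

/-- **Pointwise second-order bound for the divergence**: everywhere on `ℝ³`,
`∑ₖ (∂ₖ div (ζw))² ≤ 3 (‖Dζ‖ ‖Dw‖ + ‖D²ζ‖ ‖w‖)²`, for `ζ ∈ C²` and `w` of class `C¹` and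
divergence free on an open `U ⊇ tsupport ζ` (`div (ζw) = Dζ·w` near the support, so
`D(div (ζw)) = Dζ ∘ Dw + D²ζ(·)(w)`). [cite: Seregin2022LocalAxisym, §2 Lemma 2.1 proof (arXiv:2201.00153 p. 5)] -/
theorem sum_sq_fderiv_divergence_smul_le (hζ : ContDiff ℝ 2 ζ) (hU : IsOpen U)
    (hζU : tsupport ζ ⊆ U) (hw : ContDiffOn ℝ 1 w U)
    (hdiv : ∀ y ∈ U, VectorCalculus.divergence w y = 0) (x : EuclideanSpace ℝ (Fin 3)) :
    ∑ k, fderiv ℝ (VectorCalculus.divergence fun y => ζ y • w y) x (EuclideanSpace.single k 1) ^ 2 ≤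
      3 * (‖fderiv ℝ ζ x‖ * ‖fderiv ℝ w x‖ + ‖fderiv ℝ (fderiv ℝ ζ) x‖ * ‖w x‖) ^ 2 := by
  set M : ℝ := ‖fderiv ℝ ζ x‖ * ‖fderiv ℝ w x‖ + ‖fderiv ℝ (fderiv ℝ ζ) x‖ * ‖w x‖ with hM
  have hM0 : 0 ≤ M := by positivity
  have he : ∀ k : Fin 3, ‖(EuclideanSpace.single k (1 : ℝ) : EuclideanSpace ℝ (Fin 3))‖ = 1 :=
    fun k => by simp
  suffices h : ∀ k : Fin 3,
      |fderiv ℝ (VectorCalculus.divergence fun y => ζ y • w y) x (EuclideanSpace.single k 1)| ≤ M by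
    calc ∑ k, fderiv ℝ (VectorCalculus.divergence fun y => ζ y • w y) x
          (EuclideanSpace.single k 1) ^ 2
        ≤ ∑ _k : Fin 3, M ^ 2 := Finset.sum_le_sum fun k _ => by
          rw [← sq_abs]; exact pow_le_pow_left₀ (abs_nonneg _) (h k) 2
      _ = 3 * M ^ 2 := by simp
  intro k
  by_cases hx : x ∈ tsupport ζ
  · have hxU : x ∈ U := hζU hx
    have hwd : ∀ y ∈ U, DifferentiableAt ℝ w y := fun y hy =>
      (hw.contDiffAt (hU.mem_nhds hy)).differentiableAt one_ne_zero
    have hev := divergence_smul_eventuallyEq (hζ.of_le (by norm_num)) hU hwd hdiv hxU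
    have hDζ : DifferentiableAt ℝ (fderiv ℝ ζ) x :=
      ((hζ.fderiv_right (m := 1) (by norm_num)).differentiable one_ne_zero) x
    rw [hev.fderiv_eq, fderiv_clm_apply hDζ (hwd x hxU)]
    simp only [add_apply, ContinuousLinearMap.comp_apply, ContinuousLinearMap.flip_apply]
    have h1 : |fderiv ℝ ζ x (fderiv ℝ w x (EuclideanSpace.single k 1))| ≤
        ‖fderiv ℝ ζ x‖ * ‖fderiv ℝ w x‖ := by
      rw [← Real.norm_eq_abs]
      refine ((fderiv ℝ ζ x).le_opNorm _).trans ?_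
      gcongr
      simpa [he k] using (fderiv ℝ w x).le_opNorm (EuclideanSpace.single k (1 : ℝ))
    have h2 : |fderiv ℝ (fderiv ℝ ζ) x (EuclideanSpace.single k 1) (w x)| ≤
        ‖fderiv ℝ (fderiv ℝ ζ) x‖ * ‖w x‖ := by
      rw [← Real.norm_eq_abs]
      refine ((fderiv ℝ (fderiv ℝ ζ) x (EuclideanSpace.single k 1)).le_opNorm _).trans ?_
      gcongr
      simpa [he k] using (fderiv ℝ (fderiv ℝ ζ) x).le_opNorm (EuclideanSpace.single k (1 : ℝ))
    exact (abs_add_le _ _).trans (add_le_add h1 h2)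
  · have h0 : ∀ y ∉ tsupport ζ, VectorCalculus.divergence (fun z => ζ z • w z) y = 0 :=
      fun y hy => divergence_eq_zero_of_notMem_tsupport (notMem_tsupport_smul hy)
    rw [fderiv_eq_zero_of_forall_notMem (isClosed_tsupport ζ) h0 hx, zero_apply, abs_zero]
    exact hM0

/-- **Second-order cut-off `div`–`curl` bound** (hypothesis form). For `ζ ∈ C³_c(ℝ³)` and `w`
of class `C³` and divergence free on an open `U ⊇ tsupport ζ`,
`∫ ∑ₖ |D∂ₖ(ζw)|²_F ≤ 2 ∫ ‖curl (ζ curl w)‖² + (2‖curlCLM‖⁴ + 3) ∫ (‖Dζ‖ ‖Dw‖ + ‖D²ζ‖ ‖w‖)²`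
in `[0, ∞]` — Seregin's
`‖∇²(η³v̄)‖₂ ≤ c‖|∇η³||∇v̄|‖₂ + c‖|∇²η³||v̄|‖₂ + c‖curl (ω_θη³e_θ)‖₂` with `ζ = η³`,
`curl v̄ = ω_θ e_θ`. [cite: Seregin2022LocalAxisym, §2 Step 4 (arXiv:2201.00153 p. 7), second elliptic bound] -/
theorem lintegral_sum_frobeniusNormSq_fderiv_fderiv_smul_le' (hζ : ContDiff ℝ 3 ζ)
    (hζc : HasCompactSupport ζ) (hU : IsOpen U) (hζU : tsupport ζ ⊆ U) (hw : ContDiffOn ℝ 3 w U)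
    (hdiv : ∀ y ∈ U, VectorCalculus.divergence w y = 0) :
    ∫⁻ x, ENNReal.ofReal (∑ k, frobeniusNormSq
        (fderiv ℝ (fun y => fderiv ℝ (fun z => ζ z • w z) y (EuclideanSpace.single k 1)) x)) ≤
      2 * (∫⁻ x, ENNReal.ofReal (‖curl (fun y => ζ y • curl w y) x‖ ^ 2)) +
        ENNReal.ofReal (2 * ‖curlCLM‖ ^ 4 + 3) *
          ∫⁻ x, ENNReal.ofReal ((‖fderiv ℝ ζ x‖ * ‖fderiv ℝ w x‖ +
            ‖fderiv ℝ (fderiv ℝ ζ) x‖ * ‖w x‖) ^ 2) := by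
  set W : EuclideanSpace ℝ (Fin 3) → EuclideanSpace ℝ (Fin 3) := fun y => ζ y • w y with hW
  have hW3 : ContDiff ℝ 3 W := contDiff_cutoff_smul hζ hU hζU hw
  have hW2 : ContDiff ℝ 2 W := hW3.of_le (by norm_num)
  have hWc : HasCompactSupport W := hζc.smul_right
  have key := sum_integral_frobeniusNormSq_fderiv_fderiv_eq hW3 hWc
  have hk2 : ∀ k : Fin 3, ContDiff ℝ 2 fun y => fderiv ℝ W y (EuclideanSpace.single k 1) :=
    fun k => (hW3.fderiv_right (m := 2) (by norm_num)).clm_apply contDiff_const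
  have hc1 : ContDiff ℝ 1 (curl (curl W)) :=
    contDiff_curl (n := 1) (contDiff_curl (n := 2) (by exact_mod_cast hW3))
  have hd2 : ContDiff ℝ 2 (VectorCalculus.divergence W) :=
    contDiff_divergence (n := 2) (by exact_mod_cast hW3)
  have hD0 : ∀ y ∉ tsupport W, fderiv ℝ W y = 0 := fun y hy => fderiv_of_notMem_tsupport ℝ hy
  have hc0 : ∀ y ∉ tsupport W, curl W y = 0 := fun y hy => curl_eq_zero_of_notMem_tsupport hy
  have hd0 : ∀ y ∉ tsupport W, VectorCalculus.divergence W y = 0 := fun y hy =>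
    divergence_eq_zero_of_notMem_tsupport hy
  -- integrability
  have hiF : ∀ k : Fin 3, Integrable fun x =>
      frobeniusNormSq (fderiv ℝ (fun y => fderiv ℝ W y (EuclideanSpace.single k 1)) x) := fun k =>
    integrable_of_continuous_of_forall_notMem hWc.isCompact
      (continuous_frobeniusNormSq_fderiv (hk2 k) two_ne_zero) fun x hx => by
        rw [fderiv_eq_zero_of_forall_notMem (isClosed_tsupport W) (fun y hy => by
          show fderiv ℝ W y (EuclideanSpace.single k 1) = 0
          rw [hD0 y hy, zero_apply]) hx, frobeniusNormSq_zero]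
  have hic : Integrable fun x => ‖curl (curl W) x‖ ^ 2 :=
    integrable_of_continuous_of_forall_notMem hWc.isCompact (hc1.continuous.norm.pow 2)
      fun x hx => by
        show ‖curl (curl W) x‖ ^ 2 = 0
        rw [curl_eq_curlCLM (curl W), fderiv_eq_zero_of_forall_notMem (isClosed_tsupport W) hc0 hx,
          map_zero, norm_zero]; ring
  have hid : Integrable fun x =>
      ∑ k, fderiv ℝ (VectorCalculus.divergence W) x (EuclideanSpace.single k 1) ^ 2 :=
    integrable_of_continuous_of_forall_notMem hWc.isCompact
      (continuous_finsetSum _ fun k _ =>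
        ((hd2.continuous_fderiv two_ne_zero).clm_apply continuous_const).pow 2) fun x hx => by
        show ∑ k, fderiv ℝ (VectorCalculus.divergence W) x (EuclideanSpace.single k 1) ^ 2 = 0
        rw [fderiv_eq_zero_of_forall_notMem (isClosed_tsupport W) hd0 hx]; simp
  have hsum : Integrable fun x => ‖curl (curl W) x‖ ^ 2 +
      ∑ k, fderiv ℝ (VectorCalculus.divergence W) x (EuclideanSpace.single k 1) ^ 2 := hic.add hid
  have e1 : ∫⁻ x, ENNReal.ofReal (∑ k, frobeniusNormSq
        (fderiv ℝ (fun y => fderiv ℝ W y (EuclideanSpace.single k 1)) x)) =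
      ∫⁻ x, ENNReal.ofReal (‖curl (curl W) x‖ ^ 2 +
        ∑ k, fderiv ℝ (VectorCalculus.divergence W) x (EuclideanSpace.single k 1) ^ 2) := by
    rw [← ofReal_integral_eq_lintegral_ofReal (integrable_finsetSum _ fun k _ => hiF k)
        (ae_of_all _ fun x => Finset.sum_nonneg fun k _ => frobeniusNormSq_nonneg _),
      integral_finsetSum _ fun k _ => hiF k, key, ← integral_add hic hid,
      ofReal_integral_eq_lintegral_ofReal hsum (ae_of_all _ fun x =>
        add_nonneg (sq_nonneg _) (Finset.sum_nonneg fun k _ => sq_nonneg _))]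
  rw [e1]
  -- the pointwise bound
  have hpt : ∀ x, ‖curl (curl W) x‖ ^ 2 +
      ∑ k, fderiv ℝ (VectorCalculus.divergence W) x (EuclideanSpace.single k 1) ^ 2 ≤
      2 * ‖curl (fun y => ζ y • curl w y) x‖ ^ 2 + (2 * ‖curlCLM‖ ^ 4 + 3) *
        (‖fderiv ℝ ζ x‖ * ‖fderiv ℝ w x‖ + ‖fderiv ℝ (fderiv ℝ ζ) x‖ * ‖w x‖) ^ 2 := by
    intro x
    have hc := norm_curl_curl_smul_le (hζ.of_le (by norm_num)) hU hζU (hw.of_le (by norm_num)) x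
    have hd := sum_sq_fderiv_divergence_smul_le (hζ.of_le (by norm_num)) hU hζU
      (hw.of_le (by norm_num)) hdiv x
    set a : ℝ := ‖curl (fun y => ζ y • curl w y) x‖ with ha'
    set M : ℝ := ‖fderiv ℝ ζ x‖ * ‖fderiv ℝ w x‖ + ‖fderiv ℝ (fderiv ℝ ζ) x‖ * ‖w x‖ with hM'
    have ha : 0 ≤ a := by rw [ha']; exact norm_nonneg _
    have hM : 0 ≤ M := by rw [hM']; positivity
    have hκ0 : 0 ≤ ‖curlCLM‖ := norm_nonneg curlCLM
    have h1 : ‖curl (curl W) x‖ ^ 2 ≤ (a + ‖curlCLM‖ ^ 2 * M) ^ 2 :=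
      pow_le_pow_left₀ (norm_nonneg _) hc 2
    nlinarith [sq_nonneg (a - ‖curlCLM‖ ^ 2 * M), sq_nonneg ‖curlCLM‖]
  calc ∫⁻ x, ENNReal.ofReal (‖curl (curl W) x‖ ^ 2 +
        ∑ k, fderiv ℝ (VectorCalculus.divergence W) x (EuclideanSpace.single k 1) ^ 2)
      ≤ ∫⁻ x, ENNReal.ofReal (2 * ‖curl (fun y => ζ y • curl w y) x‖ ^ 2 +
          (2 * ‖curlCLM‖ ^ 4 + 3) *
            (‖fderiv ℝ ζ x‖ * ‖fderiv ℝ w x‖ + ‖fderiv ℝ (fderiv ℝ ζ) x‖ * ‖w x‖) ^ 2) :=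
        lintegral_mono fun x => ENNReal.ofReal_le_ofReal (hpt x)
    _ = _ := by
        have h2 : ∀ x, ENNReal.ofReal (2 * ‖curl (fun y => ζ y • curl w y) x‖ ^ 2 +
            (2 * ‖curlCLM‖ ^ 4 + 3) *
              (‖fderiv ℝ ζ x‖ * ‖fderiv ℝ w x‖ + ‖fderiv ℝ (fderiv ℝ ζ) x‖ * ‖w x‖) ^ 2) =
            2 * ENNReal.ofReal (‖curl (fun y => ζ y • curl w y) x‖ ^ 2) +
              ENNReal.ofReal (2 * ‖curlCLM‖ ^ 4 + 3) * ENNReal.ofReal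
                ((‖fderiv ℝ ζ x‖ * ‖fderiv ℝ w x‖ + ‖fderiv ℝ (fderiv ℝ ζ) x‖ * ‖w x‖) ^ 2) :=
          fun x => by
            rw [ENNReal.ofReal_add (by positivity) (by positivity), ENNReal.ofReal_mul zero_le_two,
              ENNReal.ofReal_ofNat, ENNReal.ofReal_mul (by positivity)]
        have hm : Measurable fun x => 2 * ENNReal.ofReal (‖curl (fun y => ζ y • curl w y) x‖ ^ 2) :=
          (((measurable_curl _).norm.pow_const 2).ennreal_ofReal).const_mul _
        simp_rw [h2]
        rw [lintegral_add_left hm, lintegral_const_mul' _ _ (by norm_num),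
          lintegral_const_mul' _ _ ENNReal.ofReal_ne_top]

/-- **Second-order cut-off `div`–`curl` bound (Seregin 2022, §2 Step 4, second elliptic bound:
"`‖∇²(η³v̄)‖_{2,𝒞} ≤ c‖|∇η³||∇v̄|‖_{2,𝒞} + c‖|∇²η³||v̄|‖_{2,𝒞} + c‖curl (ω_θη³e_θ)‖_{2,𝒞}`").**
For every cut-off `ζ ∈ C³_c(ℝ³)` and every field `w` of class `C³` and divergence free on an open
set `U ⊇ tsupport ζ`:
`∫ ∑ₖ |D∂ₖ(ζw)|²_F ≤ 2 ∫ ‖curl (ζ curl w)‖² + (2‖curlCLM‖⁴ + 3) ∫ (‖Dζ‖‖Dw‖ + ‖D²ζ‖‖w‖)²`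
(lower Lebesgue integrals; with `ζ = η³`, `w = v̄`, `curl v̄ = ω_θe_θ` this is the printed bound).
Registered sub-goal toward `stub_sereginLogSwirlOrigin`. [cite: Seregin2022LocalAxisym, §2 Step 4 (arXiv:2201.00153 p. 7), second elliptic bound] -/
theorem lintegral_sum_frobeniusNormSq_fderiv_fderiv_smul_le : ∀ (ζ : EuclideanSpace ℝ (Fin 3) → ℝ) (w : EuclideanSpace ℝ (Fin 3) → EuclideanSpace ℝ (Fin 3)) (U : Set (EuclideanSpace ℝ (Fin 3))), ContDiff ℝ 3 ζ → HasCompactSupport ζ → IsOpen U → tsupport ζ ⊆ U → ContDiffOn ℝ 3 w U → (∀ y ∈ U, VectorCalculus.divergence w y = 0) → ∫⁻ x, ENNReal.ofReal (∑ k, frobeniusNormSq (fderiv ℝ (fun y => fderiv ℝ (fun z => ζ z • w z) y (EuclideanSpace.single k 1)) x)) ≤ 2 * (∫⁻ x, ENNReal.ofReal (‖curl (fun y => ζ y • curl w y) x‖ ^ 2)) + ENNReal.ofReal (2 * ‖curlCLM‖ ^ 4 + 3) * ∫⁻ x, ENNReal.ofReal ((‖fderiv ℝ ζ x‖ * ‖fderiv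 ℝ w x‖ + ‖fderiv ℝ (fderiv ℝ ζ) x‖ * ‖w x‖) ^ 2) :=
  fun _ _ _ hζ hζc hU hζU hw hdiv =>
    lintegral_sum_frobeniusNormSq_fderiv_fderiv_smul_le' hζ hζc hU hζU hw hdiv

end Cutoff

end Summit.NavierStokesRegularity.NavierStokesRegularity.Theorems.AxisymmetricKatoGlobal.EulerScaling

end
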